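import Literature.Analysis.FluidPDE.SawtoothCascadeSlotDamping
import Literature.Analysis.FluidPDE.PassiveScalar
import Literature.Analysis.FluidPDE.PassiveScalarClassicalEnergy
import Summits.AnomalousDissipation.AnomalousDissipation.Theorems.SawtoothPulseCascadeK1LocalisedCascadeLedgerClose

/-!
# K1loc, line `Spectral` / SeqCone — helper: `K1Localised` FROM A UNIFORM FIRST GOOD PIECE (S-B assembly ∘ line composition)

Helper file of the prover lane on the crux `K1LocalisedCascade` (stmt-AnomalousDissipation-19491), route
`SawtoothPulseCascade` (S-B/S-C assembly seat).  The registered line `Cruxes.K1LocalisedCascade.Spectral` composes the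
crux from its one open stub `stub_highModeConcentration` by one H half-slot of shear damping
(`CascadeParams.shearSlotDamping_H`) and the energy identity; `…LedgerClose` proves that stub's BODY for the cascade
parameters `P = ⟨γ, δ₀, 2, 1, 2⟩` (`5 ≤ γ ≤ 8`, `0 < δ₀ ≤ 1/4`) from a uniform first good piece.  This file runs the same
composition for a general such `P` (the skeleton hard-codes `δ₀ = ¼`), giving
**`k1Localised_of_uniform_firstGoodPiece : … → K1Localised P (γ² − 3)`** — the tree predicate the crux (and its planned
restatement with symbolic `δ₀`) is made of.  Remaining inputs, all explicit hypotheses: the positivity of the datum's energy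
(`0 < ‖datum‖²`, discharged in the closure files by `…scalarL2Sq_datum_pos`) and the UNIFORM FIRST GOOD PIECE (S-D):
a level `q < ‖datum‖` and a start phase `i₁` such that for every `i₀ ≥ i₁` and every `η > 0` there is `κ₁ > 0` below which
every classical cascade scalar from the datum has tracked start energy `‖μᴴ_{i₀}(D) w(tStart i₀)‖ ≤ q + η`
(`…K1Start.sqrt_tsum_symbol_sq_le_of_inviscid` reduces this to ONE explicit inviscid iterate per `i₀`).  No definitions;
no statement about the crux at `δ₀ = ¼` is claimed (there the first good piece is not expected to hold).
[cite: DEIJ2022, (1.2)–(1.3)] [cite: BedrossianCotiZelati2017, §1] [problem: turb]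
-/

-- `Summit.<Summit>.<Problem>`: single-conjunct summit, the duplicate namespace segment is deliberate.
set_option linter.dupNamespace false

noncomputable section

namespace Summit.AnomalousDissipation.AnomalousDissipation.Theorems.SawtoothPulseCascade.K1Ledger

open MeasureTheory Set Filter Topology UnitAddTorus Function
open scoped ENNReal
open Literature.Analysis Literature.Analysis.FunctionSpaces Literature.Analysis.FluidPDE
open Literature.Analysis.FluidPDE.SawtoothCascade Literature.Analysis.FluidPDE.SawtoothCascade.CascadeParams

/-! ## Energy bookkeeping of a classical cascade scalar (ported from the registered skeleton, general `P`) -/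

/-- The energy identity of a classical cascade scalar in extended form on `[0, t]`, `0 ≤ t < 1`:
`‖w(t)‖² + 2·eDiss(0,t) = ‖w(0)‖²`. [cite: DEIJ2022, (1.3) (energy identity)] -/
theorem ofReal_scalarL2Sq_add_two_mul_eScalarDissipation {P : CascadeParams} {κ : ℝ} (hκ : 0 ≤ κ)
    {w : ℝ → UnitAddTorus (Fin 2) → ℝ} (hw : Torus.IsClassicalScalarTransportOn (Ico 0 1) κ P.field w) {t : ℝ}
    (ht0 : 0 ≤ t) (ht1 : t < 1) :
    ENNReal.ofReal (Torus.scalarL2Sq (w t)) + 2 * Torus.eScalarDissipation κ w 0 t =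
      ENNReal.ofReal (Torus.scalarL2Sq (w 0)) := by
  rcases ht0.eq_or_lt with h0 | ht0'
  · subst h0
    simp [Torus.eScalarDissipation]
  have hS : Icc 0 t ⊆ Ico (0 : ℝ) 1 := fun s hs => ⟨hs.1, hs.2.trans_lt ht1⟩
  have hw' := hw.restrict_Icc ht0' hS
  have hid := Torus.IsClassicalScalarTransportOn.scalarL2Sq_add_scalarDissipation_holds hw ht0'.le hS
  have hD : 0 ≤ Torus.scalarDissipation κ w 0 t := Torus.scalarDissipation_nonneg hκ w ht0'.le
  rw [Torus.eScalarDissipation_eq_ofReal hκ ht0' hw']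
  have h2 : (2 : ℝ≥0∞) * ENNReal.ofReal (Torus.scalarDissipation κ w 0 t) =
      ENNReal.ofReal (2 * Torus.scalarDissipation κ w 0 t) := by
    rw [ENNReal.ofReal_mul (by norm_num : (0 : ℝ) ≤ 2), ENNReal.ofReal_ofNat]
  rw [h2, ← ENNReal.ofReal_add (Torus.scalarL2Sq_nonneg _) (by positivity), hid]

/-- `1 ≤ 2·(1 − e^{−x})` in `ℝ≥0∞` for `x ≥ 1`. [folklore] -/
theorem one_le_two_mul_ofReal_one_sub_exp {x : ℝ} (hx : 1 ≤ x) :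
    (1 : ℝ≥0∞) ≤ 2 * ENNReal.ofReal (1 - Real.exp (-x)) := by
  have he1 : Real.exp (-x) ≤ Real.exp (-1) := Real.exp_le_exp.mpr (by linarith)
  have he2 : Real.exp (-1) ≤ 1 / 2 := by
    have h := Real.add_one_le_exp (1 : ℝ)
    rw [Real.exp_neg]
    rw [inv_le_comm₀ (Real.exp_pos 1) (by norm_num)]
    norm_num at h ⊢; linarith
  have h : (1 : ℝ) ≤ 2 * (1 - Real.exp (-x)) := by linarith
  calc (1 : ℝ≥0∞) = ENNReal.ofReal 1 := ENNReal.ofReal_one.symm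
    _ ≤ ENNReal.ofReal (2 * (1 - Real.exp (-x))) := ENNReal.ofReal_le_ofReal h
    _ = 2 * ENNReal.ofReal (1 - Real.exp (-x)) := by
        rw [ENNReal.ofReal_mul (by norm_num : (0 : ℝ) ≤ 2), ENNReal.ofReal_ofNat]

/-- **The line's composition, general `P`: the stub body gives `K1Localised P r`** (one further H half-slot of shear damping
absorbs the concentrated high horizontal modes; lag `A + 1`, same fraction `χ`).
[cite: DEIJ2022, (1.2)–(1.3)] [cite: BedrossianCotiZelati2017, §1] -/
theorem k1Localised_of_highModeConcentration (P : CascadeParams) (r : ℝ)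
    (H : ∃ χ : ℝ, 0 < χ ∧ ∃ A : ℕ, ∃ κ₀ : ℝ, 0 < κ₀ ∧ ∀ κ ∈ Ioc (0 : ℝ) κ₀,
      ∀ w : ℝ → UnitAddTorus (Fin 2) → ℝ,
        Torus.IsClassicalScalarTransportOn (Ico 0 1) κ P.field w → w 0 = datum →
        ∃ K : ℝ, 0 ≤ K ∧ 1 ≤ 8 * Real.pi ^ 2 * κ * K ^ 2 * tHalf (Jrate r κ + A) ∧
          ENNReal.ofReal (2 * χ * Torus.scalarL2Sq datum) ≤
            Torus.highModeEnergy 0 K (w (tStart (Jrate r κ + A))) +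
              2 * Torus.eScalarDissipation κ w 0 (tStart (Jrate r κ + A))) :
    K1Localised P r := by
  obtain ⟨χ, hχ, A, κ₀, hκ₀, H⟩ := H
  refine ⟨χ, hχ, A + 1, κ₀, hκ₀, fun κ hκ w hw h0 => ?_⟩
  have hκ0 : 0 ≤ κ := hκ.1.le
  obtain ⟨K, hK0, hK, hconc⟩ := H κ hκ w hw h0
  -- times
  set J : ℕ := Jrate r κ + A with hJ
  have hJ' : Jrate r κ + (A + 1) = J + 1 := by rw [hJ]; ring
  rw [hJ']
  have hT₀0 : 0 ≤ tStart J := tStart_nonneg J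
  have hT₀1 : tStart J < 1 := tStart_lt_one J
  have hT₁0 : 0 ≤ tStart J + tHalf J := by linarith [tHalf_pos J]
  have hT₁1 : tStart J + tHalf J < 1 := tStart_add_tHalf_lt_one J
  have hT₁2 : tStart J + tHalf J ≤ tStart (J + 1) := by rw [tStart_succ]; linarith [tHalf_pos J]
  -- the three energy facts
  have hS2 := P.shearSlotDamping_H hκ0 J hK0 hw
  have hid₀ := ofReal_scalarL2Sq_add_two_mul_eScalarDissipation hκ0 hw hT₀0 hT₀1
  have hid₁ := ofReal_scalarL2Sq_add_two_mul_eScalarDissipation hκ0 hw hT₁0 hT₁1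
  rw [h0] at hid₀ hid₁
  set E₀ := ENNReal.ofReal (Torus.scalarL2Sq (w (tStart J))) with hE₀
  set E₁ := ENNReal.ofReal (Torus.scalarL2Sq (w (tStart J + tHalf J))) with hE₁
  set Ed := ENNReal.ofReal (Torus.scalarL2Sq datum) with hEd
  set D₀ := 2 * Torus.eScalarDissipation κ w 0 (tStart J) with hD₀
  set D₁ := 2 * Torus.eScalarDissipation κ w 0 (tStart J + tHalf J) with hD₁
  set c := ENNReal.ofReal (1 - Real.exp (-(8 * Real.pi ^ 2 * κ * K ^ 2 * tHalf J))) with hc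
  set Hh := Torus.highModeEnergy 0 K (w (tStart J)) with hHh
  have hE₁top : E₁ ≠ ∞ := ENNReal.ofReal_ne_top
  -- `cH + D₀ ≤ D₁`
  have hstep : c * Hh + D₀ ≤ D₁ := by
    have h1 : E₁ + (c * Hh + D₀) ≤ E₁ + D₁ := by
      calc E₁ + (c * Hh + D₀) = (E₁ + c * Hh) + D₀ := by rw [add_assoc]
        _ ≤ E₀ + D₀ := by gcongr
        _ = Ed := hid₀
        _ = E₁ + D₁ := hid₁.symm
    exact (ENNReal.add_le_add_iff_left hE₁top).mp h1
  -- `ofReal(χ‖d‖²) ≤ cH + D₀`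
  have h2c : (1 : ℝ≥0∞) ≤ 2 * c := one_le_two_mul_ofReal_one_sub_exp hK
  have hX : 2 * ENNReal.ofReal (χ * Torus.scalarL2Sq datum) ≤ 2 * (c * Hh + D₀) := by
    have e2 : 2 * ENNReal.ofReal (χ * Torus.scalarL2Sq datum) = ENNReal.ofReal (2 * χ * Torus.scalarL2Sq datum) := by
      rw [mul_assoc, ENNReal.ofReal_mul (by norm_num : (0 : ℝ) ≤ 2), ENNReal.ofReal_ofNat]
    rw [e2]
    calc ENNReal.ofReal (2 * χ * Torus.scalarL2Sq datum) ≤ Hh + D₀ := hconc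
      _ = 1 * Hh + D₀ := by rw [one_mul]
      _ ≤ (2 * c) * Hh + 2 * D₀ :=
          add_le_add (by gcongr) (le_mul_of_one_le_left' (by norm_num))
      _ = 2 * (c * Hh + D₀) := by ring
  have hX' : ENNReal.ofReal (χ * Torus.scalarL2Sq datum) ≤ c * Hh + D₀ :=
    (ENNReal.mul_le_mul_iff_right (by norm_num) (by norm_num)).mp hX
  calc ENNReal.ofReal (χ * Torus.scalarL2Sq datum) ≤ c * Hh + D₀ := hX'
    _ ≤ D₁ := hstep
    _ ≤ 2 * Torus.eScalarDissipation κ w 0 (tStart (J + 1)) := by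
        rw [hD₁]
        gcongr
        exact eScalarDissipation_mono_right w hT₁2

/-- **`K1Localised P (γ² − 3)` from a UNIFORM first good piece**, for the cascade at the crux point with symbolic `δ₀`
(`N₀ = 1`, `ρN = 2`, `d = 2`, `5 ≤ γ ≤ 8`, `0 < δ₀ ≤ 1/4`; schedule radius `L₀ ≥ 1000`).  See the module docstring for the
two remaining inputs. [cite: DEIJ2022, (1.2)–(1.3)] [cite: ElgindiLissMattingly2025, §1.2 and §3.1] -/
theorem k1Localised_of_uniform_firstGoodPiece (P : CascadeParams) (hγ : 5 ≤ P.γ) (hγ' : P.γ ≤ 8)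
    (hδ₀ : 0 < P.δ₀) (hδ₀' : P.δ₀ ≤ 1 / 4) (hd : P.d = 2) (hN₀ : P.N₀ = 1) (hρN : P.ρN = 2) {L₀ : ℝ}
    (hL₀ : 1000 ≤ L₀) (hE : 0 < Torus.scalarL2Sq datum) {q : ℝ} (hq : 0 ≤ q)
    (hqE : q < Real.sqrt (Torus.scalarL2Sq datum)) {i₁ : ℕ}
    (hstart : ∀ i₀ : ℕ, i₁ ≤ i₀ →
      ∀ η : ℝ, 0 < η → ∃ κ₁ : ℝ, 0 < κ₁ ∧ ∀ κ ∈ Ioc (0 : ℝ) κ₁, ∀ w : ℝ → UnitAddTorus (Fin 2) → ℝ,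
        Torus.IsClassicalScalarTransportOn (Ico 0 1) κ P.field w → w 0 = datum →
          Real.sqrt (∑' k : Fin 2 → ℤ, (1 - Real.smoothTransition ((|((k 0 : ℤ) : ℝ)| - L₀ * ((P.γ ^ 2 - 5 / 2) / (1 + 1 / 250) ^ 2 - 1 / (2 * (1 + 1 / 250) * L₀)) ^ i₀) /
            (1 / 250 * (L₀ * ((P.γ ^ 2 - 5 / 2) / (1 + 1 / 250) ^ 2 - 1 / (2 * (1 + 1 / 250) * L₀)) ^ i₀))) *
          (1 - Real.smoothTransition ((P.γ * |((k 1 : ℤ) : ℝ)| - 13 / 10 * |((k 0 : ℤ) : ℝ)|) /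
            (1 / 20 * (L₀ * ((P.γ ^ 2 - 5 / 2) / (1 + 1 / 250) ^ 2 - 1 / (2 * (1 + 1 / 250) * L₀)) ^ i₀)))) *
        ((1 - Real.smoothTransition ((|((k 0 : ℤ) : ℝ)| - 2 * L₀ * ((1 + P.γ) ^ 2 + 1) ^ i₀) /
            (L₀ * ((P.γ ^ 2 - 5 / 2) / (1 + 1 / 250) ^ 2 - 1 / (2 * (1 + 1 / 250) * L₀)) ^ i₀ / (20 * P.γ * (1 + 1 / 250))))) *
          (1 - Real.smoothTransition ((|((k 1 : ℤ) : ℝ)| - 2 * L₀ * ((1 + P.γ) ^ 2 + 1) ^ i₀) /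
            (L₀ * ((P.γ ^ 2 - 5 / 2) / (1 + 1 / 250) ^ 2 - 1 / (2 * (1 + 1 / 250) * L₀)) ^ i₀ / (20 * P.γ * (1 + 1 / 250))))))) ^ 2 *
            ‖mFourierCoeff (fun x => (w (tStart i₀) x : ℂ)) k‖ ^ 2) ≤ q + η) :
    K1Localised P (P.γ ^ 2 - 3) :=
  k1Localised_of_highModeConcentration P (P.γ ^ 2 - 3)
    (highModeConcentration_of_uniform_firstGoodPiece P hγ hγ' hδ₀ hδ₀' hd hN₀ hρN hL₀ hE (B := 1)
      (fun _ => Real.abs_sin_le_one _) hq hqE hstart)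

end Summit.AnomalousDissipation.AnomalousDissipation.Theorems.SawtoothPulseCascade.K1Ledger
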